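import Mathlib
import Summits.NavierStokesRegularity.NavierStokesRegularity.Theorems.RootDecompLitSliceMeanFieldPairing
import Summits.NavierStokesRegularity.NavierStokesRegularity.Theorems.RootDecompLitSliceMeanFieldSliceCurrency
import Summits.NavierStokesRegularity.NavierStokesRegularity.Theorems.RootDecompLitSliceMeanFieldTimeSide
import HarnessLib

/-!
# Mean-field lever, one-step toolkit IV: the slice package and the time-integrated flux bound

Helper file for the crux `RootDecompLitSlice.CritTameScarIsCritical` (Uᶜ, stmt-…-31733), continuing
`RootDecompLitSliceMeanFieldTrilinear` / `…TimeSide` / `…SliceCurrency` / `…Pairing`. It turns the pairing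
identity `⟨u T, w⟩ − ⟨u t, w⟩ = ∫_{(t,T)} flux` (`MeanFieldPairing.inner_sub_inner_eq_integral_flux`) into a
REAL bound on `|∫_{(t,T)} flux|` for a comparison slice `w = u s₀` in terms of four scalars: the
`L²`-closeness `ℓ` of the window slices to `w`, the dissipation `m` of `w`, the energy drop `d` on the window
and the window length `τ = T − t` (blueprint steps B3–B6 of the mean-field lever).

## Contents

* §1 (generic `E`, `dim E = 3` where needed) the slice package: integrability of `|∇v|²_F`, `‖∇v‖²`,
  `‖v‖⁴`; `L³`, `L⁴` from `L² ∩ L⁶`; the trilinear integrability triple; and the pointwise-in-time flux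
  bound `enorm_flux_le`:
  `‖∫⟪(v·∇)w, v⟫ − ν Σᵢ∫⟪∂ᵢv, ∂ᵢw⟫‖ₑ ≤ ‖v − w‖₂^{1/2} (κ(F_v^{1/2} + F_w^{1/2}))^{1/2} F_w^{1/2} κ F_v^{1/2} + ν F_v^{1/2} F_w^{1/2}`
  (`F = ∫⁻|∇·|²_F`, `κ` the Sobolev constant; Hölder `3·2·6`, interpolation `‖·‖₃ ≤ ‖·‖₂^{1/2}‖·‖₆^{1/2}`,
  Sobolev `‖·‖₆ ≤ κ F^{1/2}`).
* §2 `abs_integral_flux_le` — on the classical tame frame (`ν > 0`, classical on `[0, T) × ℝ³`,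
  Leray–Hopf on `[0, T]`): if `‖u s − u s₀‖₂ ≤ ℓ` on `(t, T)`, `F(s₀) ≤ m` and `∫‖u t‖² − ∫‖u T‖² ≤ d`, then
  `|∫_{(t,T)} flux| ≤ ℓ^{1/2} κ^{3/2} m^{1/2} (τ^{1/4} (d/2ν)^{3/4} + m^{1/4} τ^{1/2} (d/2ν)^{1/2}) + ν m^{1/2} τ^{1/2} (d/2ν)^{1/2}`
  (pointwise bound integrated with the window power means of `MeanFieldTimeSide` and the energy
  inequality `∫_{(t,T)} F ≤ (∫‖u t‖² − ∫‖u T‖²)/(2ν)`).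

All statements are over accepted `Literature.Analysis.FluidPDE` declarations and Mathlib; no new
definitions. [cite: ConstantinFoias1988, Ch. 6, Ch. 8; Galdi2000, Lemma 2.1]
-/

set_option linter.dupNamespace false

namespace Summit.NavierStokesRegularity.NavierStokesRegularity.Theorems

open MeasureTheory Set Filter Topology Function Module
open scoped ENNReal NNReal RealInnerProductSpace
open Literature.Analysis.FluidPDE

namespace MeanFieldOneStep

variable {ν T : ℝ} {u : ℝ → EuclideanSpace ℝ (Fin 3) → EuclideanSpace ℝ (Fin 3)}
  {p : ℝ → EuclideanSpace ℝ (Fin 3) → ℝ}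

/-! ## §1 The slice package: a classical Leray–Hopf slice with finite dissipation -/

section Slice

variable {E : Type*} [NormedAddCommGroup E] [InnerProductSpace ℝ E] [FiniteDimensional ℝ E]
  [MeasurableSpace E] [BorelSpace E]

/-- Finite dissipation of a `C¹` field makes `|∇v|²_F` integrable. [folklore] -/
theorem integrable_frob {v : E → E} (hv : ContDiff ℝ 1 v)
    (hD : (∫⁻ x, ENNReal.ofReal (frobeniusNormSq (fderiv ℝ v x))) ≠ ⊤) :
    Integrable (fun x => frobeniusNormSq (fderiv ℝ v x)) := by
  have hc : Continuous fun x => frobeniusNormSq (fderiv ℝ v x) :=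
    NSWeakStrongUniqueness.continuous_frobeniusNormSq.comp (hv.continuous_fderiv one_ne_zero)
  exact (lintegral_ofReal_ne_top_iff_integrable hc.aestronglyMeasurable
    (Filter.Eventually.of_forall fun x => frobeniusNormSq_nonneg _)).1 hD

/-- `‖∇v‖²_op` is integrable under finite dissipation. [folklore] -/
theorem integrable_norm_fderiv_sq {v : E → E} (hv : ContDiff ℝ 1 v)
    (hD : (∫⁻ x, ENNReal.ofReal (frobeniusNormSq (fderiv ℝ v x))) ≠ ⊤) :
    Integrable (fun x => ‖fderiv ℝ v x‖ ^ 2) :=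
  (integrable_frob hv hD).mono' ((hv.continuous_fderiv one_ne_zero).norm.pow 2).aestronglyMeasurable
    (Filter.Eventually.of_forall fun x => by
      rw [Real.norm_eq_abs, abs_of_nonneg (sq_nonneg _)]
      exact sq_opNorm_le_frobeniusNormSq _)

/-- `L² ∩ L⁶ ⊂ L⁴`. [folklore] -/
theorem memLp_four_of_two_six {v : E → E} (h2 : MemLp v 2 volume) (h6 : MemLp v 6 volume) :
    MemLp v 4 volume := by
  refine ⟨h2.1, ?_⟩
  have h := eLpNorm_le_eLpNorm_two_rpow_mul_eLpNorm_six_rpow (μ := volume) h2.1 (p := 4)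
    (by norm_num) (by norm_num)
  refine h.trans_lt (ENNReal.mul_lt_top ?_ ?_)
  · exact ENNReal.rpow_lt_top_of_nonneg (by norm_num) h2.eLpNorm_ne_top
  · exact ENNReal.rpow_lt_top_of_nonneg (by norm_num) h6.eLpNorm_ne_top

/-- `L² ∩ L⁶ ⊂ L³`. [folklore] -/
theorem memLp_three_of_two_six {v : E → E} (h2 : MemLp v 2 volume) (h6 : MemLp v 6 volume) :
    MemLp v 3 volume := by
  refine ⟨h2.1, ?_⟩
  have h := eLpNorm_le_eLpNorm_two_rpow_mul_eLpNorm_six_rpow (μ := volume) h2.1 (p := 3)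
    (by norm_num) (by norm_num)
  refine h.trans_lt (ENNReal.mul_lt_top ?_ ?_)
  · exact ENNReal.rpow_lt_top_of_nonneg (by norm_num) h2.eLpNorm_ne_top
  · exact ENNReal.rpow_lt_top_of_nonneg (by norm_num) h6.eLpNorm_ne_top

/-- `‖v‖⁴` is integrable for `v ∈ L⁴`. [folklore] -/
theorem integrable_norm_pow_four {v : E → E} (h4 : MemLp v 4 volume) :
    Integrable (fun x => ‖v x‖ ^ 4) := by
  have := h4.integrable_norm_pow (by norm_num)
  simpa using this

/-- The three trilinear integrands of the convective slice bound are integrable for slices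
`v, w ∈ C¹ ∩ L² ∩ L⁶` with `∇w ∈ L²` (AM–GM majorants `‖w‖²‖v‖ ≤ (‖w‖⁴+‖v‖²)/2`,
`‖∇w‖‖v‖‖w‖ ≤ ‖∇w‖²/2 + (‖v‖⁴+‖w‖⁴)/4`, `‖∇w‖‖v‖² ≤ (‖∇w‖² + ‖v‖⁴)/2`). [folklore] -/
theorem integrable_trilinear {v w : E → E} (hv : ContDiff ℝ 1 v) (hw : ContDiff ℝ 1 w)
    (hv2 : MemLp v 2 volume) (hv6 : MemLp v 6 volume) (hw2 : MemLp w 2 volume)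
    (hw6 : MemLp w 6 volume)
    (hwD : (∫⁻ x, ENNReal.ofReal (frobeniusNormSq (fderiv ℝ w x))) ≠ ⊤) :
    Integrable (fun x => ⟪w x, w x⟫ • v x) ∧
      Integrable (fun x => ⟪convect v w x, w x⟫) ∧
      Integrable (fun x => ⟪convect v w x, v x⟫) := by
  have hv4 := integrable_norm_pow_four (memLp_four_of_two_six hv2 hv6)
  have hw4 := integrable_norm_pow_four (memLp_four_of_two_six hw2 hw6)
  have hv2' : Integrable (fun x => ‖v x‖ ^ 2) := by
    have := hv2.integrable_norm_pow (by norm_num); simpa using this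
  have hDw := integrable_norm_fderiv_sq hw hwD
  have hcv : Continuous v := hv.continuous
  have hcw : Continuous w := hw.continuous
  have hcDw : Continuous (fderiv ℝ w) := hw.continuous_fderiv one_ne_zero
  have hcc : Continuous (convect v w) := by
    show Continuous fun x => fderiv ℝ w x (v x)
    exact hcDw.clm_apply hcv
  refine ⟨?_, ?_, ?_⟩
  · refine ((hw4.add hv2').div_const 2).mono' ((hcw.inner hcw).smul hcv).aestronglyMeasurable
      (Filter.Eventually.of_forall fun x => ?_)
    rw [norm_smul, Real.norm_eq_abs, real_inner_self_eq_norm_sq, abs_of_nonneg (sq_nonneg _)]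
    have h := two_mul_le_add_sq (‖w x‖ ^ 2) ‖v x‖
    simp only [Pi.add_apply]
    nlinarith [h]
  · refine (((hDw.div_const 2).add ((hv4.add hw4).div_const 4))).mono'
      (hcc.inner hcw).aestronglyMeasurable (Filter.Eventually.of_forall fun x => ?_)
    have h1 : ‖⟪convect v w x, w x⟫‖ ≤ ‖fderiv ℝ w x‖ * ‖v x‖ * ‖w x‖ := by
      refine (norm_inner_le_norm _ _).trans ?_
      exact mul_le_mul_of_nonneg_right (ContinuousLinearMap.le_opNorm _ _) (norm_nonneg _)
    refine h1.trans ?_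
    have h2 := two_mul_le_add_sq ‖fderiv ℝ w x‖ (‖v x‖ * ‖w x‖)
    have h3 := two_mul_le_add_sq (‖v x‖ ^ 2) (‖w x‖ ^ 2)
    simp only [Pi.add_apply]
    nlinarith [h2, h3, norm_nonneg (fderiv ℝ w x), norm_nonneg (v x), norm_nonneg (w x)]
  · refine ((hDw.add hv4).div_const 2).mono' (hcc.inner hcv).aestronglyMeasurable
      (Filter.Eventually.of_forall fun x => ?_)
    have h1 : ‖⟪convect v w x, v x⟫‖ ≤ ‖fderiv ℝ w x‖ * ‖v x‖ * ‖v x‖ := by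
      refine (norm_inner_le_norm _ _).trans ?_
      exact mul_le_mul_of_nonneg_right (ContinuousLinearMap.le_opNorm _ _) (norm_nonneg _)
    refine h1.trans ?_
    have h2 := two_mul_le_add_sq ‖fderiv ℝ w x‖ (‖v x‖ ^ 2)
    simp only [Pi.add_apply]
    nlinarith [h2]

/-- Each frame entry `⟪∂ᵢv, ∂ᵢw⟫` is integrable under finite dissipations. [folklore] -/
theorem integrable_inner_fderiv_apply {v w : E → E} (hv : ContDiff ℝ 1 v) (hw : ContDiff ℝ 1 w)
    (hvD : (∫⁻ x, ENNReal.ofReal (frobeniusNormSq (fderiv ℝ v x))) ≠ ⊤)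
    (hwD : (∫⁻ x, ENNReal.ofReal (frobeniusNormSq (fderiv ℝ w x))) ≠ ⊤) (e : E) :
    Integrable (fun x => ⟪fderiv ℝ v x e, fderiv ℝ w x e⟫) := by
  have hDv := integrable_norm_fderiv_sq hv hvD
  have hDw := integrable_norm_fderiv_sq hw hwD
  have hc : Continuous fun x => ⟪fderiv ℝ v x e, fderiv ℝ w x e⟫ :=
    ((hv.continuous_fderiv one_ne_zero).clm_apply continuous_const).inner
      ((hw.continuous_fderiv one_ne_zero).clm_apply continuous_const)
  refine (((hDv.add hDw).div_const 2).mul_const (‖e‖ ^ 2)).mono' hc.aestronglyMeasurable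
    (Filter.Eventually.of_forall fun x => ?_)
  have h1 : ‖⟪fderiv ℝ v x e, fderiv ℝ w x e⟫‖ ≤ (‖fderiv ℝ v x‖ * ‖e‖) * (‖fderiv ℝ w x‖ * ‖e‖) :=
    (norm_inner_le_norm _ _).trans (mul_le_mul (ContinuousLinearMap.le_opNorm _ _)
      (ContinuousLinearMap.le_opNorm _ _) (norm_nonneg _) (by positivity))
  refine h1.trans ?_
  have h2 := two_mul_le_add_sq ‖fderiv ℝ v x‖ ‖fderiv ℝ w x‖
  simp only [Pi.add_apply]
  nlinarith [h2, sq_nonneg ‖e‖]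

/-- **Pointwise (in time) flux bound, `ℝ≥0∞` currency.** For `C¹` fields `v, w ∈ L²` on a
three-dimensional space with finite dissipations `F_v = ∫⁻|∇v|²_F`, `F_w`, `div v = 0`, and the
Sobolev constant `K_S`:
`‖∫⟪(v·∇)w, v⟫ − ν Σᵢ∫⟪∂ᵢv, ∂ᵢw⟫‖ₑ ≤ ‖v−w‖₂^{1/2} (K_S (F_v^{1/2} + F_w^{1/2}))^{1/2} F_w^{1/2} K_S F_v^{1/2} + |ν| F_v^{1/2} F_w^{1/2}`
(convective part in mean-field form `‖v−w‖₃ ‖∇w‖₂ ‖v‖₆` with `‖·‖₃ ≤ ‖·‖₂^{1/2}‖·‖₆^{1/2}` and the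
Sobolev slice inequality; viscous part by Cauchy–Schwarz). [folklore] -/
theorem enorm_flux_le (hE : finrank ℝ E = 3) {v w : E → E} (hv : ContDiff ℝ 1 v)
    (hw : ContDiff ℝ 1 w) (hdiv : VectorCalculus.IsDivFree v) (hv2 : MemLp v 2 volume)
    (hw2 : MemLp w 2 volume)
    (hvD : (∫⁻ x, ENNReal.ofReal (frobeniusNormSq (fderiv ℝ v x))) ≠ ⊤)
    (hwD : (∫⁻ x, ENNReal.ofReal (frobeniusNormSq (fderiv ℝ w x))) ≠ ⊤) (ν : ℝ) :
    ‖(∫ x, ⟪convect v w x, v x⟫) - ν * ∑ i, ∫ x, ⟪fderiv ℝ v x (stdOrthonormalBasis ℝ E i),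
        fderiv ℝ w x (stdOrthonormalBasis ℝ E i)⟫‖ₑ ≤
      eLpNorm (fun x => v x - w x) 2 volume ^ (1 / 2 : ℝ) *
          ((SNormLESNormFDerivOfEqConst E (volume : Measure E) 2 : ℝ≥0∞) *
            ((∫⁻ x, ENNReal.ofReal (frobeniusNormSq (fderiv ℝ v x))) ^ (1 / 2 : ℝ) +
              (∫⁻ x, ENNReal.ofReal (frobeniusNormSq (fderiv ℝ w x))) ^ (1 / 2 : ℝ))) ^ (1 / 2 : ℝ) *
        ((∫⁻ x, ENNReal.ofReal (frobeniusNormSq (fderiv ℝ w x))) ^ (1 / 2 : ℝ) *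
          ((SNormLESNormFDerivOfEqConst E (volume : Measure E) 2 : ℝ≥0∞) *
            (∫⁻ x, ENNReal.ofReal (frobeniusNormSq (fderiv ℝ v x))) ^ (1 / 2 : ℝ))) +
      ‖ν‖ₑ * ((∫⁻ x, ENNReal.ofReal (frobeniusNormSq (fderiv ℝ v x))) ^ (1 / 2 : ℝ) *
        (∫⁻ x, ENNReal.ofReal (frobeniusNormSq (fderiv ℝ w x))) ^ (1 / 2 : ℝ)) := by
  set Fv := ∫⁻ x, ENNReal.ofReal (frobeniusNormSq (fderiv ℝ v x)) with hFv
  set Fw := ∫⁻ x, ENNReal.ofReal (frobeniusNormSq (fderiv ℝ w x)) with hFw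
  set KS : ℝ≥0∞ := (SNormLESNormFDerivOfEqConst E (volume : Measure E) 2 : ℝ≥0∞) with hKS
  have hv6 : MemLp v 6 volume :=
    MeanFieldSliceCurrency.memLp_six_of_dissipation_ne_top volume hE hv hv2.eLpNorm_lt_top hvD
  have hw6 : MemLp w 6 volume :=
    MeanFieldSliceCurrency.memLp_six_of_dissipation_ne_top volume hE hw hw2.eLpNorm_lt_top hwD
  have hDw2 : MemLp (fderiv ℝ w) 2 volume :=
    MeanFieldSliceCurrency.memLp_fderiv_two_of_dissipation_ne_top volume hw hwD
  have hvw2 : MemLp (fun x => v x - w x) 2 volume := hv2.sub hw2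
  have hvw6 : MemLp (fun x => v x - w x) 6 volume := hv6.sub hw6
  have hvw3 : MemLp (fun x => v x - w x) 3 volume := memLp_three_of_two_six hvw2 hvw6
  obtain ⟨h0, h1, h2⟩ := integrable_trilinear hv hw hv2 hv6 hw2 hw6 hwD
  -- convective part
  have hconv := MeanFieldPairing.enorm_integral_inner_convect_right_le hv hw hdiv h0 h1 h2 hvw3 hDw2 hv6
  have h3le : eLpNorm (fun x => v x - w x) 3 volume ≤
      eLpNorm (fun x => v x - w x) 2 volume ^ (1 / 2 : ℝ) * (KS * (Fv ^ (1 / 2 : ℝ) + Fw ^ (1 / 2 : ℝ))) ^ (1 / 2 : ℝ) := by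
    refine (MeanFieldSliceCurrency.eLpNorm_three_le _ hvw2.1).trans ?_
    refine mul_le_mul' le_rfl (ENNReal.rpow_le_rpow ?_ (by norm_num))
    calc eLpNorm (fun x => v x - w x) 6 volume
        ≤ eLpNorm v 6 volume + eLpNorm w 6 volume :=
          eLpNorm_sub_le hv.continuous.aestronglyMeasurable hw.continuous.aestronglyMeasurable (by norm_num)
      _ ≤ KS * Fv ^ (1 / 2 : ℝ) + KS * Fw ^ (1 / 2 : ℝ) :=
          add_le_add (MeanFieldSliceCurrency.eLpNorm_six_le_dissipation_sqrt volume hE hv hv2.eLpNorm_lt_top)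
            (MeanFieldSliceCurrency.eLpNorm_six_le_dissipation_sqrt volume hE hw hw2.eLpNorm_lt_top)
      _ = KS * (Fv ^ (1 / 2 : ℝ) + Fw ^ (1 / 2 : ℝ)) := by rw [mul_add]
  have hD2le : eLpNorm (fderiv ℝ w) 2 volume ≤ Fw ^ (1 / 2 : ℝ) :=
    MeanFieldSliceCurrency.eLpNorm_fderiv_two_le_dissipation_sqrt volume w
  have h6le : eLpNorm v 6 volume ≤ KS * Fv ^ (1 / 2 : ℝ) :=
    MeanFieldSliceCurrency.eLpNorm_six_le_dissipation_sqrt volume hE hv hv2.eLpNorm_lt_top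
  have hconv' : ‖∫ x, ⟪convect v w x, v x⟫‖ₑ ≤
      eLpNorm (fun x => v x - w x) 2 volume ^ (1 / 2 : ℝ) * (KS * (Fv ^ (1 / 2 : ℝ) + Fw ^ (1 / 2 : ℝ))) ^ (1 / 2 : ℝ) *
        (Fw ^ (1 / 2 : ℝ) * (KS * Fv ^ (1 / 2 : ℝ))) :=
    hconv.trans (mul_le_mul' h3le (mul_le_mul' hD2le h6le))
  -- viscous part
  have hvisc := MeanFieldPairing.enorm_sum_integral_inner_fderiv_le (integrable_frob hv hvD)
    (integrable_frob hw hwD) (fun i => integrable_inner_fderiv_apply hv hw hvD hwD _)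
  -- combine
  refine (enorm_sub_le).trans (add_le_add hconv' ?_)
  rw [enorm_mul]
  exact mul_le_mul' le_rfl hvisc

end Slice

/-! ## §2 Time integration of the flux on the classical frame -/

/-- `(x^{1/2})^{1/2} = x^{1/4}` in `ℝ≥0∞`. [folklore] -/
theorem rpow_half_half (x : ℝ≥0∞) : (x ^ (1 / 2 : ℝ)) ^ (1 / 2 : ℝ) = x ^ (1 / 4 : ℝ) := by
  rw [← ENNReal.rpow_mul]; norm_num

/-- `x^{1/4} x^{1/2} = x^{3/4}` in `ℝ≥0∞`. [folklore] -/
theorem rpow_quarter_mul_half (x : ℝ≥0∞) : x ^ (1 / 4 : ℝ) * x ^ (1 / 2 : ℝ) = x ^ (3 / 4 : ℝ) := by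
  rw [← ENNReal.rpow_add_of_nonneg _ _ (by norm_num) (by norm_num)]; norm_num

/-- **Time-integrated flux bound (real currency).** On the classical tame frame, fix `t ∈ (0, T)` and a
comparison slice `w = u s₀`, `s₀ ∈ (0, T)`, with dissipation `F(s₀) ≤ m`; assume the slices `u s`,
`s ∈ (t, T)`, are `L²`-close to `w`, `‖u s − u s₀‖₂ ≤ ℓ` (as `eLpNorm (u s − u s₀) 2 ≤ ofReal ℓ`), and
the energy drop `∫‖u t‖² − ∫‖u T‖² ≤ d`. Then, with the Sobolev
constant `κ` and `τ = T − t`,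
`|∫_{(t,T)} flux| ≤ ℓ^{1/2} κ^{1/2} m^{1/2} κ (τ^{1/4} (d/2ν)^{3/4} + m^{1/4} τ^{1/2} (d/2ν)^{1/2}) + ν m^{1/2} τ^{1/2} (d/2ν)^{1/2}`
(pointwise `enorm_flux_le`, then the window power means `∫F^{3/4} ≤ τ^{1/4}(∫F)^{3/4}`,
`∫F^{1/2} ≤ τ^{1/2}(∫F)^{1/2}` and `∫_{(t,T)} F ≤ (E(t) − E(T))/(2ν)`). [folklore] -/
theorem abs_integral_flux_le (hν : 0 < ν)
    (hcl : IsClassicalNSSolutionOn (Ico 0 T) ν 0 u p) (hLH : IsLerayHopfOn T ν 0 (u 0) u)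
    {t s₀ : ℝ} (ht : t ∈ Ioo 0 T) (hs₀ : s₀ ∈ Ioo 0 T)
    (hF₀ : (∫⁻ x, ENNReal.ofReal (frobeniusNormSq (fderiv ℝ (u s₀) x))) ≠ ⊤)
    {ℓ m d : ℝ} (hℓ : 0 ≤ ℓ) (hm : 0 ≤ m) (hd : 0 ≤ d)
    (hL : ∀ s ∈ Ioo t T, eLpNorm (fun x => u s x - u s₀ x) 2 volume ≤ ENNReal.ofReal ℓ)
    (hM : (∫⁻ x, ENNReal.ofReal (frobeniusNormSq (fderiv ℝ (u s₀) x))) ≤ ENNReal.ofReal m)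
    (hD : (∫ x, ‖u t x‖ ^ 2) - ∫ x, ‖u T x‖ ^ 2 ≤ d) :
    |∫ s in Ioo t T, ((∫ x, ⟪convect (u s) (u s₀) x, u s x⟫) -
        ν * ∑ i, ∫ x, ⟪fderiv ℝ (u s) x (stdOrthonormalBasis ℝ _ i),
          fderiv ℝ (u s₀) x (stdOrthonormalBasis ℝ _ i)⟫)| ≤
      ℓ ^ (1 / 2 : ℝ) * (SNormLESNormFDerivOfEqConst (EuclideanSpace ℝ (Fin 3))
          (volume : Measure (EuclideanSpace ℝ (Fin 3))) 2 : ℝ) ^ (1 / 2 : ℝ) * m ^ (1 / 2 : ℝ) *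
          (SNormLESNormFDerivOfEqConst (EuclideanSpace ℝ (Fin 3))
            (volume : Measure (EuclideanSpace ℝ (Fin 3))) 2 : ℝ) *
        ((T - t) ^ (1 / 4 : ℝ) * (d / (2 * ν)) ^ (3 / 4 : ℝ) +
          m ^ (1 / 4 : ℝ) * ((T - t) ^ (1 / 2 : ℝ) * (d / (2 * ν)) ^ (1 / 2 : ℝ))) +
      ν * m ^ (1 / 2 : ℝ) * ((T - t) ^ (1 / 2 : ℝ) * (d / (2 * ν)) ^ (1 / 2 : ℝ)) := by
  set b := stdOrthonormalBasis ℝ (EuclideanSpace ℝ (Fin 3)) with hb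
  set X : ℝ → ℝ≥0∞ := fun s => ∫⁻ x, ENNReal.ofReal (frobeniusNormSq (fderiv ℝ (u s) x)) with hX
  set κ' : ℝ≥0∞ := (SNormLESNormFDerivOfEqConst (EuclideanSpace ℝ (Fin 3))
    (volume : Measure (EuclideanSpace ℝ (Fin 3))) 2 : ℝ≥0∞) with hκ'
  set κ : ℝ := (SNormLESNormFDerivOfEqConst (EuclideanSpace ℝ (Fin 3))
    (volume : Measure (EuclideanSpace ℝ (Fin 3))) 2 : ℝ) with hκ
  have hκ0 : 0 ≤ κ := NNReal.coe_nonneg _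
  have hκκ : κ' = ENNReal.ofReal κ := by rw [hκ, ENNReal.ofReal_coe_nnreal]
  set M : ℝ≥0∞ := ENNReal.ofReal m with hMdef
  set flux : ℝ → ℝ := fun s => (∫ x, ⟪convect (u s) (u s₀) x, u s x⟫) -
    ν * ∑ i, ∫ x, ⟪fderiv ℝ (u s) x (b i), fderiv ℝ (u s₀) x (b i)⟫ with hflux
  have hτ : 0 < T - t := sub_pos.2 ht.2
  have ht' : t ∈ Ico 0 T := ⟨ht.1.le, ht.2⟩
  -- slice data
  have hcd : ∀ s ∈ Ico 0 T, ContDiff ℝ 1 (u s) := fun s hs =>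
    (hcl.smooth_velocity.contDiff_slice hs).of_le (by norm_cast)
  have hm2 : ∀ s ∈ Ico 0 T, MemLp (u s) 2 volume := fun s hs => hLH.memLp s ⟨hs.1, hs.2.le⟩
  have hs₀' : s₀ ∈ Ico 0 T := ⟨hs₀.1.le, hs₀.2⟩
  -- a.e. finiteness of the slice dissipation on the window
  have hXm : AEMeasurable X (volume.restrict (Ioo t T)) :=
    MeanFieldTimeSide.aemeasurable_sliceDissipation_top hcl ht.1.le
  have hwin : (∫⁻ s in Ioo t T, X s) ≠ ⊤ :=
    ((MeanFieldTimeSide.windowDissipation_le hν hcl hLH ht.1.le ht.2.le le_rfl).trans_lt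
      ENNReal.ofReal_lt_top).ne
  have hfin : ∀ᵐ s ∂(volume.restrict (Ioo t T)), X s < ⊤ := ae_lt_top' hXm hwin
  -- the two coefficients
  set A : ℝ≥0∞ := ENNReal.ofReal ℓ ^ (1 / 2 : ℝ) * κ' ^ (1 / 2 : ℝ) * M ^ (1 / 2 : ℝ) * κ' with hA
  set B : ℝ≥0∞ := A * M ^ (1 / 4 : ℝ) + ‖ν‖ₑ * M ^ (1 / 2 : ℝ) with hB
  -- pointwise bound
  have hpt : ∀ᵐ s ∂(volume.restrict (Ioo t T)),
      ‖flux s‖ₑ ≤ A * X s ^ (3 / 4 : ℝ) + B * X s ^ (1 / 2 : ℝ) := by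
    filter_upwards [hfin, ae_restrict_mem measurableSet_Ioo] with s hsfin hs
    have hsI : s ∈ Ico 0 T := ⟨(ht.1.trans hs.1).le, hs.2⟩
    have h0 := enorm_flux_le MeanFieldPairing.finrank_eq_three (hcd s hsI) (hcd s₀ hs₀')
      (hcl.divFree s hsI) (hm2 s hsI) (hm2 s₀ hs₀') hsfin.ne hF₀ ν
    have h1 : ‖flux s‖ₑ ≤ ENNReal.ofReal ℓ ^ (1 / 2 : ℝ) *
        (κ' * (X s ^ (1 / 2 : ℝ) + M ^ (1 / 2 : ℝ))) ^ (1 / 2 : ℝ) *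
          (M ^ (1 / 2 : ℝ) * (κ' * X s ^ (1 / 2 : ℝ))) +
        ‖ν‖ₑ * (X s ^ (1 / 2 : ℝ) * M ^ (1 / 2 : ℝ)) := by
      refine h0.trans ?_
      have hL' := hL s hs
      gcongr
    have h2 : (κ' * (X s ^ (1 / 2 : ℝ) + M ^ (1 / 2 : ℝ))) ^ (1 / 2 : ℝ) ≤
        κ' ^ (1 / 2 : ℝ) * (X s ^ (1 / 4 : ℝ) + M ^ (1 / 4 : ℝ)) := by
      rw [ENNReal.mul_rpow_of_nonneg _ _ (by norm_num : (0 : ℝ) ≤ 1 / 2)]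
      refine mul_le_mul' le_rfl ?_
      refine (ENNReal.rpow_add_le_add_rpow _ _ (by norm_num) (by norm_num)).trans (le_of_eq ?_)
      rw [rpow_half_half, rpow_half_half]
    calc ‖flux s‖ₑ ≤ _ := h1
      _ ≤ ENNReal.ofReal ℓ ^ (1 / 2 : ℝ) * (κ' ^ (1 / 2 : ℝ) * (X s ^ (1 / 4 : ℝ) + M ^ (1 / 4 : ℝ))) *
            (M ^ (1 / 2 : ℝ) * (κ' * X s ^ (1 / 2 : ℝ))) + ‖ν‖ₑ * (X s ^ (1 / 2 : ℝ) * M ^ (1 / 2 : ℝ)) := by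
          gcongr
      _ = A * (X s ^ (1 / 4 : ℝ) * X s ^ (1 / 2 : ℝ)) + B * X s ^ (1 / 2 : ℝ) := by
          simp only [hA, hB]; ring
      _ = A * X s ^ (3 / 4 : ℝ) + B * X s ^ (1 / 2 : ℝ) := by rw [rpow_quarter_mul_half]
  -- integrate in time
  have hI : (∫⁻ s in Ioo t T, ‖flux s‖ₑ) ≤
      A * (∫⁻ s in Ioo t T, X s ^ (3 / 4 : ℝ)) + B * ∫⁻ s in Ioo t T, X s ^ (1 / 2 : ℝ) := by
    refine (lintegral_mono_ae hpt).trans (le_of_eq ?_)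
    rw [lintegral_add_left' ((hXm.pow_const _).const_mul _), lintegral_const_mul'' _ (hXm.pow_const _),
      lintegral_const_mul'' _ (hXm.pow_const _)]
  have h34 := MeanFieldTimeSide.windowDissipation_rpow_le_energyDrop hν hcl hLH ht'
    (by norm_num : (0 : ℝ) < 3 / 4) (by norm_num : (3 / 4 : ℝ) < 1)
  have h12 := MeanFieldTimeSide.windowDissipation_rpow_le_energyDrop hν hcl hLH ht'
    (by norm_num : (0 : ℝ) < 1 / 2) (by norm_num : (1 / 2 : ℝ) < 1)
  have hdν : 0 ≤ d / (2 * ν) := by positivity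
  have hEd : ENNReal.ofReal (((∫ x, ‖u t x‖ ^ 2) - ∫ x, ‖u T x‖ ^ 2) / (2 * ν)) ≤
      ENNReal.ofReal (d / (2 * ν)) :=
    ENNReal.ofReal_le_ofReal (div_le_div_of_nonneg_right hD (by positivity))
  set I₁ : ℝ := (T - t) ^ (1 / 4 : ℝ) * (d / (2 * ν)) ^ (3 / 4 : ℝ) with hI₁
  set I₂ : ℝ := (T - t) ^ (1 / 2 : ℝ) * (d / (2 * ν)) ^ (1 / 2 : ℝ) with hI₂
  have hI₁0 : 0 ≤ I₁ := mul_nonneg (Real.rpow_nonneg hτ.le _) (Real.rpow_nonneg hdν _)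
  have hI₂0 : 0 ≤ I₂ := mul_nonneg (Real.rpow_nonneg hτ.le _) (Real.rpow_nonneg hdν _)
  have h34' : (∫⁻ s in Ioo t T, X s ^ (3 / 4 : ℝ)) ≤ ENNReal.ofReal I₁ := by
    calc (∫⁻ s in Ioo t T, X s ^ (3 / 4 : ℝ)) ≤ _ := h34
      _ = ENNReal.ofReal (T - t) ^ (1 / 4 : ℝ) *
          ENNReal.ofReal (((∫ x, ‖u t x‖ ^ 2) - ∫ x, ‖u T x‖ ^ 2) / (2 * ν)) ^ (3 / 4 : ℝ) := by
          norm_num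
      _ ≤ ENNReal.ofReal (T - t) ^ (1 / 4 : ℝ) * ENNReal.ofReal (d / (2 * ν)) ^ (3 / 4 : ℝ) :=
          mul_le_mul' le_rfl (ENNReal.rpow_le_rpow hEd (by norm_num))
      _ = ENNReal.ofReal I₁ := by
          rw [hI₁, ENNReal.ofReal_mul (Real.rpow_nonneg hτ.le _),
            ENNReal.ofReal_rpow_of_nonneg hτ.le (by norm_num),
            ENNReal.ofReal_rpow_of_nonneg hdν (by norm_num)]
  have h12' : (∫⁻ s in Ioo t T, X s ^ (1 / 2 : ℝ)) ≤ ENNReal.ofReal I₂ := by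
    calc (∫⁻ s in Ioo t T, X s ^ (1 / 2 : ℝ)) ≤ _ := h12
      _ = ENNReal.ofReal (T - t) ^ (1 / 2 : ℝ) *
          ENNReal.ofReal (((∫ x, ‖u t x‖ ^ 2) - ∫ x, ‖u T x‖ ^ 2) / (2 * ν)) ^ (1 / 2 : ℝ) := by
          norm_num
      _ ≤ ENNReal.ofReal (T - t) ^ (1 / 2 : ℝ) * ENNReal.ofReal (d / (2 * ν)) ^ (1 / 2 : ℝ) :=
          mul_le_mul' le_rfl (ENNReal.rpow_le_rpow hEd (by norm_num))
      _ = ENNReal.ofReal I₂ := by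
          rw [hI₂, ENNReal.ofReal_mul (Real.rpow_nonneg hτ.le _),
            ENNReal.ofReal_rpow_of_nonneg hτ.le (by norm_num),
            ENNReal.ofReal_rpow_of_nonneg hdν (by norm_num)]
  -- the coefficients as `ofReal`
  set c₁ : ℝ := ℓ ^ (1 / 2 : ℝ) * κ ^ (1 / 2 : ℝ) * m ^ (1 / 2 : ℝ) * κ with hc₁
  set c₂ : ℝ := c₁ * m ^ (1 / 4 : ℝ) + ν * m ^ (1 / 2 : ℝ) with hc₂
  have hc₁0 : 0 ≤ c₁ := by positivity
  have hc₂0 : 0 ≤ c₂ := by positivity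
  have hAr : A = ENNReal.ofReal c₁ := by
    simp only [hA, hMdef, hκκ, hc₁]
    rw [ENNReal.ofReal_rpow_of_nonneg hℓ (by norm_num), ENNReal.ofReal_rpow_of_nonneg hκ0 (by norm_num),
      ENNReal.ofReal_rpow_of_nonneg hm (by norm_num), ← ENNReal.ofReal_mul (by positivity),
      ← ENNReal.ofReal_mul (by positivity), ← ENNReal.ofReal_mul (by positivity)]
  have hBr : B = ENNReal.ofReal c₂ := by
    simp only [hB, hAr, hMdef, hc₂]
    rw [ENNReal.ofReal_rpow_of_nonneg hm (by norm_num), ENNReal.ofReal_rpow_of_nonneg hm (by norm_num),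
      Real.enorm_eq_ofReal hν.le, ← ENNReal.ofReal_mul hc₁0, ← ENNReal.ofReal_mul hν.le,
      ← ENNReal.ofReal_add (by positivity) (by positivity)]
  have hsum : ENNReal.ofReal (c₁ * I₁ + c₂ * I₂) =
      ENNReal.ofReal c₁ * ENNReal.ofReal I₁ + ENNReal.ofReal c₂ * ENNReal.ofReal I₂ := by
    rw [ENNReal.ofReal_add (mul_nonneg hc₁0 hI₁0) (mul_nonneg hc₂0 hI₂0), ENNReal.ofReal_mul hc₁0,
      ENNReal.ofReal_mul hc₂0]
  have hR : (∫⁻ s in Ioo t T, ‖flux s‖ₑ) ≤ ENNReal.ofReal (c₁ * I₁ + c₂ * I₂) := by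
    refine hI.trans ?_
    rw [hsum, hAr, hBr]
    exact add_le_add (mul_le_mul' le_rfl h34') (mul_le_mul' le_rfl h12')
  -- back to the Bochner integral
  have hnorm : ‖∫ s in Ioo t T, flux s‖ ≤ (∫⁻ s in Ioo t T, ‖flux s‖ₑ).toReal := by
    have := norm_integral_le_lintegral_norm (μ := volume.restrict (Ioo t T)) flux
    simpa only [ofReal_norm] using this
  rw [← Real.norm_eq_abs]
  refine hnorm.trans ((ENNReal.toReal_le_of_le_ofReal (by positivity) hR).trans (le_of_eq ?_))
  simp only [hc₂, hc₁, hI₁, hI₂]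
  ring

end MeanFieldOneStep
end Summit.NavierStokesRegularity.NavierStokesRegularity.Theorems
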